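import Literature.NumberTheory.LFunctions.ConreyIwaniec2002CircleMethodDefs
import HarnessLib

/-!
# Conrey–Iwaniec (2002), §3: the vocabulary of the weight-one summation formula (values of `q`-series, the `ω`-relation (3.4), the constant term of `θ(z;ψ)`, Proposition 3.1 as an interface)

B. Conrey, H. Iwaniec, *Spacing of zeros of Hecke `L`-functions and the class number problem*,
Acta Arith. 103 (2002) 259–312 [held text `paper:arxiv-math_0111012`, chunks p0006–p0010].
DEFINITIONS ONLY, for the cell `landau-siegel/ls-inputs` sub-line `theta-voronoi` (SUB-SKELETON S3d)
towards the registered stub S3d `ConreyIwaniec2002.stub_voronoi_theta` of SKELETON S3 (the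
summation datum `IsVoronoiDatum` for the class-group theta series `θ(z;ψ)`, Propositions 3.2/3.3);
the three stubs of that sub-skeleton (V1 transformation law, V2 Proposition 3.1 at weight one,
V3 the leading constant) are stated over the present vocabulary and that of
`ConreyIwaniec2002CircleMethodDefs.lean` (`IsVoronoiDatum`, `ciBesselKernel`, `IsGenusCharFor`,
`voronoiMainCoeff`). Nothing is asserted here.

## What the source prints

**§3 (3.1)–(3.4), (3.10)** (p0008:L40–70). "Suppose we have two functions `A(z)`, `B(z)` on `ℍ`
given by Fourier series `A(z) = Σ_{n≥0}a_ne(nz)` (3.1), `B(z) = Σ_{n≥0}b_ne(nz)` (3.2) with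
`a_n, b_n ≪ n^{k−1+ε}`. Suppose that `A(z), B(z)` are connected by the `ω`-stroke operator, say
`A|_ω(z) = ηB(z)` (3.3) for some `ω = (a b; c d) ∈ SL₂(ℝ)` with `c > 0` and some complex number
`η ≠ 0`. In particular for `z = (−d+iy)/c` we have `(iy)^{−k}A(a/c + i/(cy)) = ηB(−d/c + iy/c)` (3.4)
for any `y > 0`." `a_n = n^{(k−1)/2}a(n)`, `b_n = n^{(k−1)/2}b(n)` (3.10) (so `a_n = a(n)` at `k = 1`).

**Proposition 3.1 (3.11)** (p0008:L100–110). "Then for any `g(x)` smooth and compactly supported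
on `ℝ⁺` we have `Σ_{n≥1}a(n)e(an/c)g(n) = 2πi^k(η/c){(b₀/Γ(k))∫₀^∞g(x)(2π√x/c)^{k−1}dx +
Σ_{n≥1}b(n)e(−dn/c)∫₀^∞g(x)J_{k−1}((4π/c)√(nx))dx}` (3.11)." For `ω` of (3.16),
`ω = (a√r, b/√r; c√r, d√r)`, the lower-left entry is `c√r`, `a/c` and `−d/c` are unchanged and
the kernel is `J₀((4π/c)√(nx/r))` ((3.14), (3.21)).

**§2 (2.14), (2.16)–(2.17)** (p0006:L25–49). `θ_𝒜(z) = ½ + Σ_{𝔞∈𝒜}e(zN𝔞)` (2.14);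
`θ(z;ψ) = Σ_𝒜ψ(𝒜)θ_𝒜(z)` (2.16) `= Σ_{n≥0}λ_ψ(n)e(nz)` (2.17) "with `λ_ψ(0) = δ_ψh/2`".

## Lean rendering / design choices (audit notes)

* `thetaValue lam a₀ x y` = the value `A(x + iy) = a₀ + Σ_{n≥1}a(n)e(nx)e^{−2πny}` of a weight-one
  `q`-series (a `tsum` over `n ≥ 1` plus the constant term); no upper half-plane structure is
  used — the relation (3.4) is all Proposition 3.1 consumes.
* `IsOmegaRelated C η lamA lamB a₀ b₀ xA xB` = (3.4) at `k = 1` for all `y > 0`, with `C` the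
  lower-left entry of `ω`, `xA = a/c`, `xB = −d/c`.
* `thetaConst K ψ` = `½Σ_𝒜ψ(𝒜)` = the constant term `λ_ψ(0)` of `θ(z;ψ)` by (2.14)/(2.16) (equal to
  `δ_ψh/2` by orthogonality — not asserted here).
* `HeckeVoronoiWeightOne` = Proposition 3.1 at `k = 1` as an interface, generic in the
  coefficient sequences, with `C = c√r` (`c, r ≥ 1`), the kernel written as `ciBesselKernel`
  (`J₀((4π/c)√(nx/r)) = J₀((4π/C)√(nx))`), test functions of class `C²` compactly supported in
  `(0,∞)` (print: "smooth"; cf. `IsVoronoiDatum`), coefficients `|a(n)|, |b(n)| ≤ Mτ(n)` (print: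
  `≪ n^{k−1+ε}`; divisor-boundedness, (6.42), keeps the dual series absolutely convergent for `C²`
  test functions), the dual series a `HasSum`, the phases `e(nx_A)`, `e(nx_B)` for real `x_A, x_B`.

WHAT THIS IS NOT: no theorem of the source is asserted — neither Proposition 3.1 nor the
transformation law of `θ(z;ψ)`. «The programme SEARCHES and TYPES; no claim about Landau–Siegel
zeros, Theorems 1–2 of arXiv:2211.02515 or a repaired Margin232 until a kernel theorem says so.»

## References

* [ConreyIwaniec2002] B. Conrey, H. Iwaniec, Acta Arith. 103 (2002) 259–312, arXiv:math/0111012: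
  §2 (2.14), (2.16)–(2.17); §3 (3.1)–(3.4), (3.10), Proposition 3.1 (3.11)–(3.13), (3.14), (3.16),
  (3.21).
-/

noncomputable section

open scoped NumberField FourierTransform
open Complex MeasureTheory

namespace Literature.NumberTheory.LFunctions

namespace ConreyIwaniec2002

open NumberField Literature.NumberTheory.LFunctions.NumberField

/-- **The value at `z = x + iy` of a weight-one `q`-series** `A(z) = a₀ + Σ_{n≥1} a(n)e(nz)`
((3.1)/(3.2) with (3.10) at `k = 1`; `e(n(x+iy)) = e(nx)e^{−2πny}`).
[cite: ConreyIwaniec2002, §3 (3.1)–(3.2), (3.10)] -/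
def thetaValue (lam : ℕ → ℂ) (a₀ : ℂ) (x y : ℝ) : ℂ :=
  a₀ + ∑' n : ℕ, lam (n + 1) * (𝐞 (((n : ℝ) + 1) * x) : ℂ) *
    (Real.exp (-(2 * Real.pi * ((n : ℝ) + 1) * y)) : ℂ)

/-- **The `ω`-relation (3.3) in the pointwise form (3.4) at weight one**:
`(iy)⁻¹·A(x_A + i/(Cy)) = η·B(x_B + iy/C)` for all `y > 0` (for `ω = (∗ ∗; C, ∗)` with
`x_A = a/c`, `x_B = −d/c` in (3.4), `C` the lower-left entry). [cite: ConreyIwaniec2002, §3 (3.3)–(3.4)] -/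
def IsOmegaRelated (C : ℝ) (η : ℂ) (lamA lamB : ℕ → ℂ) (a₀ b₀ : ℂ) (xA xB : ℝ) : Prop :=
  ∀ y : ℝ, 0 < y →
    (I * y)⁻¹ * thetaValue lamA a₀ xA (1 / (C * y)) = η * thetaValue lamB b₀ xB (y / C)

/-- **The constant term of `θ(z;ψ)`**: `½Σ_{𝒜 ∈ Cl(K)} ψ(𝒜)` ((2.14): `θ_𝒜 = ½ + Σ_{𝔞∈𝒜}e(zN𝔞)`,
(2.16): `θ(z;ψ) = Σ_𝒜ψ(𝒜)θ_𝒜(z)`; `= δ_ψ·h/2` (2.17)). [cite: ConreyIwaniec2002, §2 (2.14), (2.16)–(2.17)] -/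
def thetaConst (K : Type*) [Field K] [NumberField K] (ψ : ClassGroup (𝓞 K) →* ℂˣ) : ℂ :=
  (1 / 2 : ℂ) * ∑ A : ClassGroup (𝓞 K), ((ψ A : ℂˣ) : ℂ)

/-- **Proposition 3.1 at weight `k = 1`, as an interface** (generic in the coefficients): if
`A`, `B` with `|a(n)|, |b(n)| ≤ M·τ(n)` (print: `a_n, b_n ≪ n^{k−1+ε}`; divisor-boundedness is what
the theta series satisfy, (6.42), and what makes the dual series converge absolutely for `C²` test
functions, `|∫gJ₀| ≪ n^{−5/4}`) satisfy the relation (3.4) with `η ≠ 0` and `C = c√r`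
(`c, r ≥ 1`), then for every `g` of class `C²` compactly supported in `(0,∞)`,
`Σ_{n≥1}a(n)e(nx_A)g(n) = (2πiη/C){b₀∫₀^∞g + Σ_{n≥1}b(n)e(nx_B)∫₀^∞g(x)J₀((4π/C)√(nx))dx}` (3.11),
the dual series recorded as a `HasSum`, the kernel as `ciBesselKernel` (`(4π/c)√(nx/r) = (4π/C)√(nx)`).
[cite: ConreyIwaniec2002, Proposition 3.1 (3.11), (3.12)–(3.13)] -/
def HeckeVoronoiWeightOne : Prop :=
  ∀ (c r : ℕ), 1 ≤ c → 1 ≤ r → ∀ (η : ℂ), η ≠ 0 → ∀ (M : ℝ) (lamA lamB : ℕ → ℂ),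
    (∀ n : ℕ, ‖lamA n‖ ≤ M * (Nat.divisors n).card) → (∀ n : ℕ, ‖lamB n‖ ≤ M * (Nat.divisors n).card) →
      ∀ (a₀ b₀ : ℂ) (xA xB : ℝ),
        IsOmegaRelated ((c : ℝ) * Real.sqrt r) η lamA lamB a₀ b₀ xA xB →
          ∀ g : ℝ → ℂ, ContDiff ℝ 2 g → (∃ X₁ X₂ : ℝ, 0 < X₁ ∧ ∀ x ∉ Set.Icc X₁ X₂, g x = 0) →
            HasSum
              (fun m : ℕ ↦ (2 * Real.pi * I * η / ((c : ℝ) * Real.sqrt r)) * lamB (m + 1) *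
                (𝐞 (((m : ℝ) + 1) * xB) : ℂ) *
                ∫ x in Set.Ioi (0 : ℝ), g x * ciBesselKernel (fun _ ↦ r) c (m + 1) x)
              ((∑' n : ℕ, lamA n * (𝐞 ((n : ℝ) * xA) : ℂ) * g n) -
                (2 * Real.pi * I * η / ((c : ℝ) * Real.sqrt r)) * b₀ * ∫ x in Set.Ioi (0 : ℝ), g x)

end ConreyIwaniec2002

end Literature.NumberTheory.LFunctions

end
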